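import Literature.AlgebraicGeometry.Resolution.ConjugateDiscsIntegral
import Mathlib.Algebra.Polynomial.BigOperators
import HarnessLib

/-!
# The `m`-rational disc coordinate lies on the `K`-rational chart

Topic: `Literature/AlgebraicGeometry/Resolution` (valued function fields; models of discs over
valuation rings). Conclusion of the conjugate-discs analysis (`ConjugateDiscs.lean`,
`ConjugateDiscsIntegral.lean`) for the algebraization step of M. Temkin, *Inseparable local
uniformization*, J. Algebra 373 (2013) = arXiv:0804.1554v3, Thm. 3.3.1, Step 3 (p. 45): the
`m`-rational disc `|x − a| ≤ |c|` around a terminal point is cut out of a `K`-RATIONAL model.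
Finite-level statement: let `T ⊆ Ω` be the chart ring of the point (a subring of the ambient
valued field `(Ω, V)` satisfying the valuative membership criterion of an étale chart over a
normal model, `EtaleChartNormal.lean`: an element lying in every valuation ring `W ⊇ T` and
having a fraction form `u z = t`, `u, t ∈ T`, lies in `T`), containing `x`, the `k`-rational disc
function `g` (`g · c′ = Q(x)^e`, `Q(x) = ∏ (x − aᵢ)` over ALL conjugates `aᵢ ∈ M` of `a`) and
the integers `m° = m ∩ V` of the small constant field `m ∋ a, c` (the disc function enters as
`g₁ · ν · c′ = Q(x)^e` with `g₁ ∈ T` and a constant `ν ∈ M ∩ V`); suppose every valuation ring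
`W ⊇ T` either contains the constants `M` or induces `V ∩ M` on `M` (unique extension below the
henselization, `UniqueExtensionBelowHenselization.lean`), and the far product
`F = ∏_{far} (X − aᵢ)` has coefficients in `m` (Galois symmetry). Then the separating function
`b = F(x)/F(a)` lies in `T`, is a unit at the point, and `b · (x − a)/c ∈ T`: the disc
coordinate `(x − a)/c` lies in the localization `T[1/b]`, an étale neighbourhood of the point.

* `exists_mul_mem_valuationSubring_of_finset` — common denominators in `m° = m ∩ V` — PROVED;
* `conjProd_eq_eval_div` — `b = F(x)/F(a)` — PROVED;
* `conjProd_mem_and_mul_sub_div_mem` — **`b ∈ T`, `|b|_V = 1`, `b (x − a)/c ∈ T`** — PROVED.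

All statements are [folklore]; no definitions, no named facts.

## Sources

* M. Temkin, arXiv:0804.1554v3, proof of Thm. 3.3.1, Step 3 (p. 45) (the use; there via
  semistable reduction, Weierstrass domains and norms).
-/

noncomputable section

open scoped BigOperators
open Polynomial

namespace Literature.AlgebraicGeometry.Resolution

namespace ConjugateDiscs

universe u

variable {Ω : Type u} [Field Ω] (V : ValuationSubring Ω)

/-! ### Bookkeeping -/

/-- A polynomial with coefficients in a subring evaluates into it at its elements. [folklore] -/
private theorem eval_mem_of_coeff_mem (S : Subring Ω) {q : Ω[X]} (hq : ∀ i, q.coeff i ∈ S)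
    {z : Ω} (hz : z ∈ S) : q.eval z ∈ S := by
  rw [Polynomial.eval_eq_sum_range]
  exact Subring.sum_mem _ fun i _ => Subring.mul_mem _ (hq i) (Subring.pow_mem _ hz i)

/-- **Common denominators in `m ∩ V`**: finitely many elements of a subfield `m` are brought
into `V` by one non-zero multiplier `d ∈ m ∩ V`. [folklore] -/
theorem exists_mul_mem_valuationSubring_of_finset (m : Subfield Ω) (Z : Finset Ω)
    (hZ : ∀ z ∈ Z, z ∈ m) :
    ∃ d : Ω, d ∈ m ∧ d ∈ V ∧ d ≠ 0 ∧ ∀ z ∈ Z, d * z ∈ V := by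
  classical
  induction Z using Finset.induction_on with
  | empty => exact ⟨1, m.one_mem, V.one_mem, one_ne_zero, fun z hz => (Finset.notMem_empty z hz).elim⟩
  | insert z Z hzZ ih =>
    obtain ⟨d, hdm, hdV, hd0, hdZ⟩ := ih fun w hw => hZ w (Finset.mem_insert_of_mem hw)
    have hzm : z ∈ m := hZ z (Finset.mem_insert_self z Z)
    rcases V.mem_or_inv_mem z with hzV | hzV
    · refine ⟨d, hdm, hdV, hd0, fun w hw => ?_⟩
      rcases Finset.mem_insert.mp hw with rfl | hw
      · exact mul_mem hdV hzV
      · exact hdZ w hw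
    · by_cases hz0 : z = 0
      · refine ⟨d, hdm, hdV, hd0, fun w hw => ?_⟩
        rcases Finset.mem_insert.mp hw with rfl | hw
        · rw [hz0, mul_zero]; exact V.zero_mem
        · exact hdZ w hw
      · refine ⟨d * z⁻¹, m.mul_mem hdm (m.inv_mem hzm), mul_mem hdV hzV,
          mul_ne_zero hd0 (inv_ne_zero hz0), fun w hw => ?_⟩
        rcases Finset.mem_insert.mp hw with rfl | hw
        · rw [mul_assoc, inv_mul_cancel₀ hz0, mul_one]; exact hdV
        · rw [mul_right_comm]; exact mul_mem (hdZ w hw) hzV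

variable {I : Type u} [Fintype I] (a : I → Ω) (i₀ : I) (c : Ω)

/-- The far product `F = ∏_{far} (X − aᵢ)`. (Abbreviation inside statements; near/far as seen by
the valuation of the point.) [folklore] -/
theorem conjProd_eq_eval_div (x : Ω) :
    conjProd V.valuation a i₀ (V.valuation c) x =
      (∏ i ∈ far V.valuation a i₀ (V.valuation c), (X - C (a i))).eval x /
        (∏ i ∈ far V.valuation a i₀ (V.valuation c), (X - C (a i))).eval (a i₀) := by
  rw [conjProd, Polynomial.eval_prod, Polynomial.eval_prod, ← Finset.prod_div_distrib]
  refine Finset.prod_congr rfl fun i _ => ?_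
  rw [eval_sub, eval_X, eval_C, eval_sub, eval_X, eval_C]

/-- The far product does not vanish at the centre. [folklore] -/
theorem eval_farProd_ne_zero :
    (∏ i ∈ far V.valuation a i₀ (V.valuation c), (X - C (a i))).eval (a i₀) ≠ 0 := by
  rw [Polynomial.eval_prod]
  refine Finset.prod_ne_zero_iff.mpr fun i hi => ?_
  rw [eval_sub, eval_X, eval_C]
  exact far_ne_i₀ hi

/-- **The disc coordinate lies on the chart.** See the module docstring: with `M` the big
constant field (all conjugates `aᵢ`, the radius `c`), `m ≤ Ω` the small one (`a = a_{i₀}`,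
`c ∈ m`, `m ∩ V ⊆ T`, the far product `m`-rational), `T` the chart ring (`x, g₁ ∈ T`, valuative
membership criterion `hT`), every valuation ring over `T` containing `M` or inducing `V ∩ M`
(`hW`), `M ∩ V` of height one (`hArch`), `g₁ ν · c′ = Q(x)^e` (`hgQ`, `ν ∈ M ∩ V`) and the
point in the disc
(`hΔ : |x − a| ≤ |c|`): the separating function `b` lies in `T`, `|b|_V = 1`, and
`b · (x − a)/c ∈ T`. [folklore] -/
theorem conjProd_mem_and_mul_sub_div_mem (M m : Subfield Ω) (ha : ∀ i, a i ∈ M) (hcM : c ∈ M)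
    (hc0 : c ≠ 0) (hcV : c ∈ V) (ha₀m : a i₀ ∈ m) (ha₀V : a i₀ ∈ V) (hcm : c ∈ m)
    (hArch : ∀ μ ∈ M, μ ∉ V → ∀ ν ∈ M, ∃ n : ℕ, ν * μ⁻¹ ^ n ∈ V)
    (T : Subring Ω) (hmT : ∀ μ ∈ m, μ ∈ V → μ ∈ T) {x g₁ ν : Ω} (hxT : x ∈ T) (hg₁T : g₁ ∈ T)
    (hνM : ν ∈ M) (hνV : ν ∈ V)
    {e : ℕ} (he : e ≠ 0) (hgQ : g₁ * ν * cNorm V a i₀ c e = (∏ i, (x - a i)) ^ e)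
    (hFm : ∀ j, (∏ i ∈ far V.valuation a i₀ (V.valuation c), (X - C (a i))).coeff j ∈ m)
    (hT : ∀ z : Ω, (∀ W : ValuationSubring Ω, T ≤ W.toSubring → z ∈ W) →
      (∃ u ∈ T, u ≠ 0 ∧ u * z ∈ T) → z ∈ T)
    (hW : ∀ W : ValuationSubring Ω, T ≤ W.toSubring →
      (∀ μ ∈ M, μ ∈ W) ∨ (∀ μ ∈ M, μ ∈ W ↔ μ ∈ V))
    (hΔ : V.valuation (x - a i₀) ≤ V.valuation c) :
    conjProd V.valuation a i₀ (V.valuation c) x ∈ T ∧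
      V.valuation (conjProd V.valuation a i₀ (V.valuation c) x) = 1 ∧
      conjProd V.valuation a i₀ (V.valuation c) x * ((x - a i₀) / c) ∈ T := by
  classical
  set γ := V.valuation c with hγ
  set b := conjProd V.valuation a i₀ γ x with hb
  set F : Ω[X] := ∏ i ∈ far V.valuation a i₀ γ, (X - C (a i)) with hF
  -- Step 1: `b` and `b (x − a)/c` lie in every valuation ring over `T`
  have hWmem : ∀ W : ValuationSubring Ω, T ≤ W.toSubring →
      b ∈ W ∧ b * (x - a i₀) / c ∈ W := by
    intro W hTW
    rcases hW W hTW with hMW | hMV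
    · -- `W` contains all the constants
      have hxW : x ∈ W := hTW hxT
      have hbW : b ∈ W := by
        rw [hb, conjProd]
        refine W.toSubring.prod_mem fun i hi => ?_
        rw [div_eq_mul_inv]
        exact W.toSubring.mul_mem (W.toSubring.sub_mem hxW (hMW _ (ha i)))
          (hMW _ (M.inv_mem (M.sub_mem (ha i₀) (ha i))))
      refine ⟨hbW, ?_⟩
      rw [div_eq_mul_inv]
      exact W.toSubring.mul_mem (W.toSubring.mul_mem hbW (W.toSubring.sub_mem hxW (hMW _ (ha i₀))))
        (hMW _ (M.inv_mem hcM))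
    · -- `W` induces `V ∩ M`: the conjugate-discs estimate over the model `B = (M ∩ V)[x, g]`
      set B : Subring Ω := Subring.closure ({μ : Ω | μ ∈ M ∧ μ ∈ V} ∪ {x, g₁}) with hB
      have hMB : ∀ μ ∈ M, μ ∈ V → μ ∈ B := fun μ hμM hμV =>
        Subring.subset_closure (Or.inl ⟨hμM, hμV⟩)
      have hxB : x ∈ B := Subring.subset_closure (Or.inr (Set.mem_insert _ _))
      have hg₁B : g₁ ∈ B := Subring.subset_closure (Or.inr (Set.mem_insert_of_mem _ rfl))
      have hgB : g₁ * ν ∈ B := B.mul_mem hg₁B (hMB ν hνM hνV)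
      have hBW : B ≤ W.toSubring := by
        refine Subring.closure_le.mpr ?_
        rintro μ (⟨hμM, hμV⟩ | hμ)
        · exact (hMV μ hμM).mpr hμV
        · rcases hμ with rfl | rfl
          · exact hTW hxT
          · exact hTW hg₁T
      exact mem_valuationSubring_of_model V M a i₀ c ha hcM hc0 hArch B hMB hxB hgB he hgQ W hBW
  -- Step 2: fraction forms, through the `m`-rational far product
  have hbF : F.eval (a i₀) * b = F.eval x := by
    rw [hb, conjProd_eq_eval_div, ← hF, mul_div_cancel₀ _ (eval_farProd_ne_zero V a i₀ c)]
  -- a common denominator `d ∈ m ∩ V` for the coefficients of `F` and `F(a)`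
  obtain ⟨d, hdm, hdV, hd0, hdZ⟩ := exists_mul_mem_valuationSubring_of_finset V m
    (insert (F.eval (a i₀)) ((Finset.range (F.natDegree + 1)).image fun j => F.coeff j)) (by
      intro z hz
      rcases Finset.mem_insert.mp hz with rfl | hz
      · exact eval_mem_of_coeff_mem m.toSubring hFm ha₀m
      · obtain ⟨j, -, rfl⟩ := Finset.mem_image.mp hz
        exact hFm j)
  have hdF : ∀ j, (C d * F).coeff j ∈ T := by
    intro j
    rw [coeff_C_mul]
    by_cases hj : j ≤ F.natDegree
    · exact hmT _ (m.mul_mem hdm (hFm j)) (hdZ _ (Finset.mem_insert_of_mem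
        (Finset.mem_image.mpr ⟨j, Finset.mem_range.mpr (Nat.lt_succ_of_le hj), rfl⟩)))
    · rw [coeff_eq_zero_of_natDegree_lt (not_le.mp hj), mul_zero]
      exact T.zero_mem
  have hdFx : d * F.eval x ∈ T := by
    have h := eval_mem_of_coeff_mem T hdF hxT
    rwa [eval_mul, eval_C] at h
  set u : Ω := d * F.eval (a i₀) with hu
  have huT : u ∈ T := hmT _ (m.mul_mem hdm (eval_mem_of_coeff_mem m.toSubring hFm ha₀m))
    (hdZ _ (Finset.mem_insert_self _ _))
  have hu0 : u ≠ 0 := mul_ne_zero hd0 (eval_farProd_ne_zero V a i₀ c)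
  have hub : u * b = d * F.eval x := by rw [hu, mul_assoc, hbF]
  -- Step 3: conclude with the membership criterion
  have hbT : b ∈ T := hT b (fun W hTW => (hWmem W hTW).1) ⟨u, huT, hu0, by rw [hub]; exact hdFx⟩
  have hvb : V.valuation b = 1 := valuation_conjProd_eq_one_of_le hΔ
  refine ⟨hbT, hvb, hT _ (fun W hTW => ?_) ⟨u * c, T.mul_mem huT (hmT c hcm hcV),
    mul_ne_zero hu0 hc0, ?_⟩⟩
  · have h := (hWmem W hTW).2
    rwa [mul_div_assoc] at h
  · have : u * c * (b * ((x - a i₀) / c)) = d * F.eval x * (x - a i₀) := by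
      calc u * c * (b * ((x - a i₀) / c)) = u * b * (x - a i₀) * (c / c) := by ring
        _ = u * b * (x - a i₀) := by rw [div_self hc0, mul_one]
        _ = d * F.eval x * (x - a i₀) := by rw [hub]
    rw [this]
    exact T.mul_mem hdFx (T.sub_mem hxT (hmT _ ha₀m ha₀V))

end ConjugateDiscs

end Literature.AlgebraicGeometry.Resolution

end
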